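import Mathlib
import Literature.NumberTheory.Transcendental.ExpVarieties

/-!
# R1: free coset-line sparsity implies the dimension-drop form — crux stmt-Schanuel-0969

Line `kernel-arithmetic-selection`, registered stub `stub_cosetLineSparsity_of_free` (R1,
`--supports stmt-Schanuel-0969`).

**Statement.** FCS⁺ ⟹ FCS♭.  FCS⁺ (the hypothesis) says: a fibre-finite coset family
`q : ℤ → ℂ^ι` of ℚ-linearly independent exponential points of a Zariski closed `W ⊆ ℂ^ι × ℂ^ι`,
indexed by `J ⊆ ℤ`, with every direction of a lattice `Λ ≤ ℤ^ι` constant ("dead") along `J`,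
`dim W + rank Λ < #ι`, and free modulo `Λ` along every sub-family of positive upper Banach density,
has upper Banach density zero.  FCS♭ (the conclusion) replaces the data `(W, Λ)` and the freeness by
the "dimension-drop" hypothesis: along every sub-family `J'` of positive upper Banach density and
for every lattice `Λ` dead along `J'` there is a closed `W ⊇ {(q_j, e^{q_j}) : j ∈ J'}` with
`dim W + rank Λ < #ι`.

Densities are in window-count form throughout: `S ⊆ ℤ` has *positive upper Banach density* when
`∃ δ > 0, ∀ N₀, ∃ N ≥ N₀, ∃ a, δ N ≤ #(S ∩ [a, a + N))`, and *upper Banach density zero* when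
`∀ δ > 0, ∃ N₀, ∀ N ≥ N₀, ∀ a, #(S ∩ [a, a + N)) < δ N` (literally the negation).

**Proof.** Purely combinatorial / ℤ-linear algebra (`IsZariskiClosed`, `zariskiDim` are never
unfolded).  Suppose some `J₁ ⊆ J` has positive upper Banach density.  Among all such sub-families
pick `J*` maximising the rank of its dead lattice `Λ(J*)` (`exists_deadLattice`, rank `≤ #ι`,
`Nat.findGreatest`).  FCS♭ gives a closed `W*` through the points of `J*` with
`dim W* + rank Λ(J*) < #ι`; FCS⁺ applied to `(W*, J*, Λ(J*))` then says `J*` has density zero — a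
contradiction — provided the family is free modulo `Λ(J*)` along every positive-density
`J'' ⊆ J*`.  Freeness: if a direction `M`, no nonzero multiple of which is in `Λ(J*)`, took finitely
many values on `J''`, then by partition regularity of upper Banach density
(`exists_piece_of_posDensity`) it is constant on a positive-density piece `J''' ⊆ J''`, so
`M ∈ Λ(J''') ≥ Λ(J*)` and `rank Λ(J''') ≥ rank Λ(J*) + 1` (`finrank_add_one_le_of_free`, via
`LinearIndependent.finCons'`), contradicting maximality.
-/

noncomputable section

set_option linter.dupNamespace false

namespace Summit.Schanuel.Schanuel.Cruxes.MinimalCounterexampleInAcl.KernelArithmeticSelection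

open Literature.NumberTheory.Transcendental

/-! ## Upper Banach density: window counts and partition regularity -/

/-- The window count of `S` in `[a, a + N)` is the cardinality of the filtered finset. [folklore] -/
theorem ncard_window_eq_card_filter (S : Set ℤ) [DecidablePred (· ∈ S)] (a : ℤ) (N : ℕ) :
    Set.ncard {j : ℤ | j ∈ Finset.Ico a (a + (N : ℤ)) ∧ j ∈ S}
      = ((Finset.Ico a (a + (N : ℤ))).filter (· ∈ S)).card := by
  rw [← Set.ncard_coe_finset, Finset.coe_filter]

/-- Window counts are subadditive under a finite cover. [folklore] -/
theorem ncard_window_le_sum {α : Type*} (F : Finset α) (A : α → Set ℤ) {S : Set ℤ}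
    (hcover : S ⊆ ⋃ w ∈ F, A w) (a : ℤ) (N : ℕ) :
    Set.ncard {j : ℤ | j ∈ Finset.Ico a (a + (N : ℤ)) ∧ j ∈ S}
      ≤ ∑ w ∈ F, Set.ncard {j : ℤ | j ∈ Finset.Ico a (a + (N : ℤ)) ∧ j ∈ A w} := by
  classical
  simp only [ncard_window_eq_card_filter]
  calc ((Finset.Ico a (a + (N : ℤ))).filter (· ∈ S)).card
      ≤ (F.biUnion fun w => (Finset.Ico a (a + (N : ℤ))).filter (· ∈ A w)).card := by
        refine Finset.card_le_card fun j hj => ?_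
        simp only [Finset.mem_filter, Finset.mem_biUnion] at hj ⊢
        obtain ⟨hjI, hjS⟩ := hj
        obtain ⟨w, hw, hjw⟩ := Set.mem_iUnion₂.1 (hcover hjS)
        exact ⟨w, hw, hjI, hjw⟩
    _ ≤ ∑ w ∈ F, ((Finset.Ico a (a + (N : ℤ))).filter (· ∈ A w)).card := Finset.card_biUnion_le

/-- **Partition regularity of upper Banach density.** If `S` has positive upper Banach density
(window-count form) and is covered by finitely many sets `A w`, `w ∈ F`, then some `A w` has
positive upper Banach density. [folklore] -/
theorem exists_piece_of_posDensity {α : Type*} {S : Set ℤ} {δ : ℝ} (hδ : 0 < δ)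
    (hwin : ∀ N₀ : ℕ, ∃ N : ℕ, N₀ ≤ N ∧ ∃ a : ℤ,
      δ * (N : ℝ) ≤ (Set.ncard {j : ℤ | j ∈ Finset.Ico a (a + (N : ℤ)) ∧ j ∈ S} : ℝ))
    (F : Finset α) (A : α → Set ℤ) (hcover : S ⊆ ⋃ w ∈ F, A w) :
    ∃ w ∈ F, ∃ δ' : ℝ, 0 < δ' ∧ ∀ N₀ : ℕ, ∃ N : ℕ, N₀ ≤ N ∧ ∃ a : ℤ,
      δ' * (N : ℝ) ≤ (Set.ncard {j : ℤ | j ∈ Finset.Ico a (a + (N : ℤ)) ∧ j ∈ A w} : ℝ) := by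
  by_contra hnone
  push Not at hnone
  set δ' : ℝ := δ / ((F.card : ℝ) + 1) with hδ'
  have hδ'pos : 0 < δ' := by positivity
  -- every piece has density zero at the parameter `δ'`; pick the corresponding thresholds
  have hzero : ∀ w, ∃ N₀ : ℕ, w ∈ F → ∀ N : ℕ, N₀ ≤ N → ∀ a : ℤ,
      (Set.ncard {j : ℤ | j ∈ Finset.Ico a (a + (N : ℤ)) ∧ j ∈ A w} : ℝ) < δ' * (N : ℝ) := by
    intro w
    by_cases hw : w ∈ F
    · obtain ⟨N₀, hN₀⟩ := hnone w hw δ' hδ'pos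
      exact ⟨N₀, fun _ => hN₀⟩
    · exact ⟨0, fun h => absurd h hw⟩
  choose N₀ hN₀ using hzero
  obtain ⟨N, hN, a, ha⟩ := hwin (F.sup N₀ + 1)
  have hNpos : (0 : ℝ) < N := by exact_mod_cast (show 0 < N by omega)
  have hN₀le : ∀ w ∈ F, N₀ w ≤ N := fun w hw => (Finset.le_sup hw).trans (by omega)
  have h1 : (Set.ncard {j : ℤ | j ∈ Finset.Ico a (a + (N : ℤ)) ∧ j ∈ S} : ℝ)
      ≤ ∑ w ∈ F, (Set.ncard {j : ℤ | j ∈ Finset.Ico a (a + (N : ℤ)) ∧ j ∈ A w} : ℝ) := by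
    exact_mod_cast ncard_window_le_sum F A hcover a N
  have h2 : ∑ w ∈ F, (Set.ncard {j : ℤ | j ∈ Finset.Ico a (a + (N : ℤ)) ∧ j ∈ A w} : ℝ)
      ≤ ∑ w ∈ F, δ' * (N : ℝ) :=
    Finset.sum_le_sum fun w hw => (hN₀ w hw N (hN₀le w hw) a).le
  have h3 : ∑ w ∈ F, δ' * (N : ℝ) = (F.card : ℝ) * (δ' * N) := by
    rw [Finset.sum_const, nsmul_eq_mul]
  have h4 : (F.card : ℝ) * (δ' * N) < δ * N := by
    have hδeq : δ = ((F.card : ℝ) + 1) * δ' := by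
      rw [hδ']
      field_simp
    rw [hδeq]
    nlinarith
  linarith

/-- Partition regularity for the fibres of a function with finitely many values on a set `S` of
positive upper Banach density: some fibre `{j ∈ S | f j = w}` has positive upper Banach density.
[folklore] -/
theorem exists_fibre_of_posDensity {β : Type*} {S : Set ℤ} {δ : ℝ} (hδ : 0 < δ)
    (hwin : ∀ N₀ : ℕ, ∃ N : ℕ, N₀ ≤ N ∧ ∃ a : ℤ,
      δ * (N : ℝ) ≤ (Set.ncard {j : ℤ | j ∈ Finset.Ico a (a + (N : ℤ)) ∧ j ∈ S} : ℝ))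
    (f : ℤ → β) (hfin : (f '' S).Finite) :
    ∃ w, ∃ δ' : ℝ, 0 < δ' ∧ ∀ N₀ : ℕ, ∃ N : ℕ, N₀ ≤ N ∧ ∃ a : ℤ,
      δ' * (N : ℝ) ≤
        (Set.ncard {j : ℤ | j ∈ Finset.Ico a (a + (N : ℤ)) ∧ j ∈ {k : ℤ | k ∈ S ∧ f k = w}} : ℝ) := by
  obtain ⟨w, -, hw⟩ := exists_piece_of_posDensity hδ hwin hfin.toFinset
    (fun w => {k : ℤ | k ∈ S ∧ f k = w})
    (fun j hj => Set.mem_iUnion₂.2 ⟨f j, hfin.mem_toFinset.2 ⟨j, hj, rfl⟩, hj, rfl⟩)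
  exact ⟨w, hw⟩

/-! ## Dead lattices -/

/-- **The dead lattices of a family exist as sublattices of `ℤ^ι`.** For `q : ℤ → ℂ^ι` there is an
assignment `J' ↦ Λ(J')` of a `ℤ`-submodule of `ℤ^ι` to every set of indices, whose members are
exactly the integer directions `M` with the pairing `∑ i, M i * q j i` constant along `J'`
(closed under `0`, `+` and integer multiples since the pairing is additive in `M`). [folklore] -/
theorem exists_deadLattice {ι : Type} [Fintype ι] (q : ℤ → ι → ℂ) :
    ∃ Λf : Set ℤ → Submodule ℤ (ι → ℤ), ∀ (J' : Set ℤ) (M : ι → ℤ),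
      M ∈ Λf J' ↔ ∀ j ∈ J', ∀ j' ∈ J', (∑ i, (M i : ℂ) * q j i) = ∑ i, (M i : ℂ) * q j' i := by
  refine ⟨fun J' =>
    { carrier := {M | ∀ j ∈ J', ∀ j' ∈ J', (∑ i, (M i : ℂ) * q j i) = ∑ i, (M i : ℂ) * q j' i}
      zero_mem' := by
        intro _ _ _ _
        simp
      add_mem' := by
        intro M M' hM hM' j hj j' hj'
        have h1 := hM j hj j' hj'
        have h2 := hM' j hj j' hj'
        simp only [Pi.add_apply, Int.cast_add, add_mul, Finset.sum_add_distrib, h1, h2]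
      smul_mem' := by
        intro m M hM j hj j' hj'
        have h1 := hM j hj j' hj'
        simp only [Pi.smul_apply, smul_eq_mul, Int.cast_mul, mul_assoc, ← Finset.mul_sum, h1] },
    fun _ _ => Iff.rfl⟩

/-- A sublattice of `ℤ^ι` has rank at most `#ι`. [folklore] -/
theorem finrank_submodule_le_card {ι : Type} [Fintype ι] (Λ : Submodule ℤ (ι → ℤ)) :
    Module.finrank ℤ Λ ≤ Fintype.card ι :=
  (Submodule.finrank_le _).trans (Module.finrank_fintype_fun_eq_card ℤ).le

/-- **Rank goes up by a free direction.** If `Λ ≤ D` are sublattices of `ℤ^ι` and `M ∈ D` has no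
nonzero multiple in `Λ`, then `rank Λ + 1 ≤ rank D`. [folklore] -/
theorem finrank_add_one_le_of_free {ι : Type} [Fintype ι] {Λ D : Submodule ℤ (ι → ℤ)}
    (hle : Λ ≤ D) {M : ι → ℤ} (hMD : M ∈ D) (hfree : ∀ m : ℤ, m ≠ 0 → m • M ∉ Λ) :
    Module.finrank ℤ Λ + 1 ≤ Module.finrank ℤ D := by
  obtain ⟨m, b⟩ := Submodule.basisOfPid (Pi.basisFun ℤ ι) Λ
  have hrank : Module.finrank ℤ Λ = m := by
    rw [Module.finrank_eq_card_basis b, Fintype.card_fin]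
  have hvli : LinearIndependent ℤ (fun k => Submodule.inclusion hle (b k)) :=
    b.linearIndependent.map' (Submodule.inclusion hle) (Submodule.ker_inclusion _ _ hle)
  have hcons : LinearIndependent ℤ
      (Fin.cons ⟨M, hMD⟩ (fun k => Submodule.inclusion hle (b k)) : Fin (m + 1) → D) := by
    refine LinearIndependent.finCons' _ _ hvli fun c y hy hcy => ?_
    have hyΛ : ((y : D) : ι → ℤ) ∈ Λ := by
      have hspan : Submodule.span ℤ (Set.range fun k => Submodule.inclusion hle (b k))
          ≤ LinearMap.range (Submodule.inclusion hle) := by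
        rw [Submodule.span_le]
        rintro _ ⟨k, rfl⟩
        exact ⟨b k, rfl⟩
      obtain ⟨z, hz⟩ := hspan hy
      rw [← hz, Submodule.coe_inclusion]
      exact z.2
    by_contra hc
    refine hfree c hc ?_
    have h0 : c • M + ((y : D) : ι → ℤ) = 0 := by
      have := congrArg (fun x : D => (x : ι → ℤ)) hcy
      simpa using this
    rw [eq_neg_of_add_eq_zero_left h0]
    exact Λ.neg_mem hyΛ
  have := hcons.fintype_card_le_finrank
  rw [Fintype.card_fin] at this
  omega

/-! ## The reduction -/

/-- **Core of R1 (curried form).** Under FCS⁺ (specialised to the ambient data `ι, i₀, c, q`) and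
the FCS♭ hypotheses for the family `q` along `J`, no sub-family `J₁ ⊆ J` has positive upper
Banach density. [folklore] -/
theorem false_of_posDensity_of_flat {ι : Type} [Fintype ι] (i₀ : ι) (c : ℂ) (J : Set ℤ)
    (q : ℤ → ι → ℂ)
    (hFCS : ∀ (W : Set (ι ⊕ ι → ℂ)) (J₀ : Set ℤ) (Λ : Submodule ℤ (ι → ℤ)),
      IsZariskiClosed ℂ W →
      zariskiDim ℂ W + ((Module.finrank ℤ ↥Λ : ℕ) : WithBot ℕ∞) < ((Fintype.card ι : ℕ) : WithBot ℕ∞) →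
      (∀ j ∈ J₀, LinearIndependent ℚ (q j) ∧ Sum.elim (q j) (Complex.exp ∘ q j) ∈ W ∧
        q j i₀ = c + 2 * ↑Real.pi * Complex.I * (j : ℂ)) →
      (∀ ω : ι → ℂ, Set.Finite {j : ℤ | j ∈ J₀ ∧ Complex.exp ∘ q j = ω}) →
      (∀ M ∈ Λ, ∀ j ∈ J₀, ∀ j' ∈ J₀, (∑ i, (M i : ℂ) * q j i) = ∑ i, (M i : ℂ) * q j' i) →
      (∀ J' ⊆ J₀, (∃ δ : ℝ, 0 < δ ∧ ∀ N₀ : ℕ, ∃ N : ℕ, N₀ ≤ N ∧ ∃ a : ℤ,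
          δ * (N : ℝ) ≤ (Set.ncard {j : ℤ | j ∈ Finset.Ico a (a + (N : ℤ)) ∧ j ∈ J'} : ℝ)) →
        ∀ M : ι → ℤ, (∀ m : ℤ, m ≠ 0 → m • M ∉ Λ) →
          Set.Infinite ((fun j => ∑ i, (M i : ℂ) * q j i) '' J')) →
      ∀ δ : ℝ, 0 < δ → ∃ N₀ : ℕ, ∀ N : ℕ, N₀ ≤ N → ∀ a : ℤ,
        (Set.ncard {j : ℤ | j ∈ Finset.Ico a (a + (N : ℤ)) ∧ j ∈ J₀} : ℝ) < δ * (N : ℝ))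
    (hLI : ∀ j ∈ J, LinearIndependent ℚ (q j) ∧ q j i₀ = c + 2 * ↑Real.pi * Complex.I * (j : ℂ))
    (hfib : ∀ ω : ι → ℂ, Set.Finite {j : ℤ | j ∈ J ∧ Complex.exp ∘ q j = ω})
    (hflat : ∀ J' ⊆ J, (∃ δ : ℝ, 0 < δ ∧ ∀ N₀ : ℕ, ∃ N : ℕ, N₀ ≤ N ∧ ∃ a : ℤ,
        δ * (N : ℝ) ≤ (Set.ncard {j : ℤ | j ∈ Finset.Ico a (a + (N : ℤ)) ∧ j ∈ J'} : ℝ)) →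
      ∀ Λ : Submodule ℤ (ι → ℤ),
        (∀ M ∈ Λ, ∀ j ∈ J', ∀ j' ∈ J', (∑ i, (M i : ℂ) * q j i) = ∑ i, (M i : ℂ) * q j' i) →
        ∃ W : Set (ι ⊕ ι → ℂ), IsZariskiClosed ℂ W ∧
          zariskiDim ℂ W + ((Module.finrank ℤ ↥Λ : ℕ) : WithBot ℕ∞) < ((Fintype.card ι : ℕ) : WithBot ℕ∞) ∧
          ∀ j ∈ J', Sum.elim (q j) (Complex.exp ∘ q j) ∈ W)
    {J₁ : Set ℤ} (hJ₁ : J₁ ⊆ J) {δ : ℝ} (hδ : 0 < δ)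
    (hwin : ∀ N₀ : ℕ, ∃ N : ℕ, N₀ ≤ N ∧ ∃ a : ℤ,
      δ * (N : ℝ) ≤ (Set.ncard {j : ℤ | j ∈ Finset.Ico a (a + (N : ℤ)) ∧ j ∈ J₁} : ℝ)) : False := by
  classical
  -- ### the dead lattices `Λ(J')` of `q`, antitone in `J'`, of rank `≤ #ι`
  obtain ⟨dead, hmem⟩ := exists_deadLattice q
  have hanti : ∀ {J' J'' : Set ℤ}, J'' ⊆ J' → dead J' ≤ dead J'' := fun h M hM =>
    (hmem _ M).2 fun j hj j' hj' => (hmem _ M).1 hM j (h hj) j' (h hj')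
  -- ### a positive-density sub-family with dead lattice of maximal rank
  set P : ℕ → Prop := fun t => ∃ J' ⊆ J, (∃ δ : ℝ, 0 < δ ∧ ∀ N₀ : ℕ, ∃ N : ℕ, N₀ ≤ N ∧ ∃ a : ℤ,
      δ * (N : ℝ) ≤ (Set.ncard {j : ℤ | j ∈ Finset.Ico a (a + (N : ℤ)) ∧ j ∈ J'} : ℝ)) ∧
    Module.finrank ℤ (dead J') = t with hP
  have hP₁ : P (Module.finrank ℤ (dead J₁)) := ⟨J₁, hJ₁, ⟨δ, hδ, hwin⟩, rfl⟩
  obtain ⟨Js, hJsJ, hJspos, hJsrank⟩ : P (Nat.findGreatest P (Fintype.card ι)) :=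
    Nat.findGreatest_spec (finrank_submodule_le_card (dead J₁)) hP₁
  have hmax : ∀ J' ⊆ J, (∃ δ : ℝ, 0 < δ ∧ ∀ N₀ : ℕ, ∃ N : ℕ, N₀ ≤ N ∧ ∃ a : ℤ,
      δ * (N : ℝ) ≤ (Set.ncard {j : ℤ | j ∈ Finset.Ico a (a + (N : ℤ)) ∧ j ∈ J'} : ℝ)) →
      Module.finrank ℤ (dead J') ≤ Nat.findGreatest P (Fintype.card ι) :=
    fun J' hJ' hp => Nat.le_findGreatest (finrank_submodule_le_card (dead J')) ⟨J', hJ', hp, rfl⟩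
  -- ### the closed set supplied by FCS♭
  obtain ⟨W, hW, hdim, hpts⟩ :=
    hflat Js hJsJ hJspos (dead Js) (fun M hM => (hmem Js M).1 hM)
  -- ### FCS⁺ applied to `(W, Js, Λ(Js))`
  have hzero : ∀ δ : ℝ, 0 < δ → ∃ N₀ : ℕ, ∀ N : ℕ, N₀ ≤ N → ∀ a : ℤ,
      (Set.ncard {j : ℤ | j ∈ Finset.Ico a (a + (N : ℤ)) ∧ j ∈ Js} : ℝ) < δ * (N : ℝ) := by
    refine hFCS W Js (dead Js) hW hdim ?_ ?_ (fun M hM => (hmem Js M).1 hM) ?_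
    · intro j hj
      exact ⟨(hLI j (hJsJ hj)).1, hpts j hj, (hLI j (hJsJ hj)).2⟩
    · intro ω
      exact (hfib ω).subset fun j hj => ⟨hJsJ hj.1, hj.2⟩
    · -- freeness modulo the maximal dead lattice
      intro J'' hJ'' hpos'' M hMfree hfin
      obtain ⟨δ'', hδ'', hwin''⟩ := hpos''
      obtain ⟨w, hw⟩ :=
        exists_fibre_of_posDensity hδ'' hwin'' (fun j => ∑ i, (M i : ℂ) * q j i) hfin
      have hJ₃J : {k : ℤ | k ∈ J'' ∧ (∑ i, (M i : ℂ) * q k i) = w} ⊆ Js := fun j hj => hJ'' hj.1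
      have hMD : M ∈ dead {k : ℤ | k ∈ J'' ∧ (∑ i, (M i : ℂ) * q k i) = w} :=
        (hmem _ M).2 fun j hj j' hj' => hj.2.trans hj'.2.symm
      have h1 := finrank_add_one_le_of_free (hanti hJ₃J) hMD hMfree
      have h2 := hmax _ (hJ₃J.trans hJsJ) hw
      omega
  -- ### density zero of `Js` contradicts its positive density
  obtain ⟨δs, hδs, hwins⟩ := hJspos
  obtain ⟨N₀, hN₀⟩ := hzero δs hδs
  obtain ⟨N, hN, a, ha⟩ := hwins N₀
  exact (not_le.mpr (hN₀ N hN a)) ha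

/-- **Stub R1 — FCS⁺ ⟹ FCS♭, THE DIMENSION-DROP FORM (abstract; registered signature).**  If a
fibre-finite coset family of ℚ-linearly independent points admits, along EVERY sub-family `J'` of
positive upper Banach density and for EVERY lattice `Λ` of directions constant along `J'`, a
Zariski closed `W ⊇ {(q_j, e^{q_j}) : j ∈ J'}` with `dim W + rank Λ < #ι`, then — granted free
coset-line sparsity FCS⁺ (the hypothesis) — it has upper Banach density zero.  Proof: maximal-rank
dead lattice + partition regularity of upper Banach density (`false_of_posDensity_of_flat`).
[folklore] -/
theorem stub_cosetLineSparsity_of_free : (∀ (ι : Type) [Fintype ι] (i₀ : ι) (W : Set (ι ⊕ ι → ℂ)) (c : ℂ) (J : Set ℤ) (q : ℤ → ι → ℂ) (Λ : Submodule ℤ (ι → ℤ)), Literature.NumberTheory.Transcendental.IsZariskiClosed ℂ W → Literature.NumberTheory.Transcendental.zariskiDim ℂ W + ((Module.finrank ℤ ↥Λ : ℕ) : WithBot ℕ∞) < ((Fintype.card ι : ℕ) : WithBot ℕ∞) → (∀ j ∈ J, LinearIndependent ℚ (q j) ∧ Sum.elim (q j) (Complex.exp ∘ q j) ∈ W ∧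 q j i₀ = c + 2 * ↑Real.pi * Complex.I * (j : ℂ)) → (∀ ω : ι → ℂ, Set.Finite {j : ℤ | j ∈ J ∧ Complex.exp ∘ q j = ω}) → (∀ M ∈ Λ, ∀ j ∈ J, ∀ j' ∈ J, (∑ i, (M i : ℂ) * q j i) = ∑ i, (M i : ℂ) * q j' i) → (∀ J' ⊆ J, (∃ δ : ℝ, 0 < δ ∧ ∀ N₀ : ℕ, ∃ N : ℕ, N₀ ≤ N ∧ ∃ a : ℤ, δ * (N : ℝ) ≤ (Set.ncard {j : ℤ | j ∈ Finset.Ico a (a + (N : ℤ)) ∧ j ∈ J'} : ℝ)) → ∀ M : ι → ℤ, (∀ m : ℤ, m ≠ 0 → m • M ∉ Λ) → Set.Infinite ((fun j => ∑ i, (M i : ℂ) * q j i) '' J')) → ∀ δ : ℝ, 0 < δ → ∃ N₀ : ℕ, ∀ N : ℕ, N₀ ≤ N → ∀ a : ℤ, (Set.ncard {j : ℤ | j ∈ Finset.Ico a (a + (N : ℤ)) ∧ j ∈ J} : ℝ) < δ * (N : ℝ)) → ∀ (ι : Type) [Fintype ι] (i₀ : ι) (c : ℂ) (J : Set ℤ)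 (q : ℤ → ι → ℂ), (∀ j ∈ J, LinearIndependent ℚ (q j) ∧ q j i₀ = c + 2 * ↑Real.pi * Complex.I * (j : ℂ)) → (∀ ω : ι → ℂ, Set.Finite {j : ℤ | j ∈ J ∧ Complex.exp ∘ q j = ω}) → (∀ J' ⊆ J, (∃ δ : ℝ, 0 < δ ∧ ∀ N₀ : ℕ, ∃ N : ℕ, N₀ ≤ N ∧ ∃ a : ℤ, δ * (N : ℝ) ≤ (Set.ncard {j : ℤ | j ∈ Finset.Ico a (a + (N : ℤ)) ∧ j ∈ J'} : ℝ)) → ∀ Λ : Submodule ℤ (ι → ℤ), (∀ M ∈ Λ, ∀ j ∈ J', ∀ j' ∈ J', (∑ i, (M i : ℂ) * q j i) = ∑ i, (M i : ℂ) * q j' i) → ∃ W : Set (ι ⊕ ι → ℂ), Literature.NumberTheory.Transcendental.IsZariskiClosed ℂ W ∧ Literature.NumberTheory.Transcendental.zariskiDim ℂ W + ((Module.finrank ℤ ↥Λ : ℕ) : WithBot ℕ∞) < ((Fintype.card ι : ℕ) : WithBot ℕ∞) ∧ ∀ j ∈ J', Sum.elim (q j) (Complex.exp ∘ q j) ∈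 W) → ∀ δ : ℝ, 0 < δ → ∃ N₀ : ℕ, ∀ N : ℕ, N₀ ≤ N → ∀ a : ℤ, (Set.ncard {j : ℤ | j ∈ Finset.Ico a (a + (N : ℤ)) ∧ j ∈ J} : ℝ) < δ * (N : ℝ) := by
  intro hFCS ι _ i₀ c J q hLI hfib hflat δ hδ
  by_contra hcon
  push Not at hcon
  exact false_of_posDensity_of_flat i₀ c J q (fun W J₀ Λ => hFCS ι i₀ W c J₀ q Λ) hLI hfib hflat
    subset_rfl hδ hcon

end Summit.Schanuel.Schanuel.Cruxes.MinimalCounterexampleInAcl.KernelArithmeticSelection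

end
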